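import Summits.QuantumFields.BalabanUV.Beta.RowD1JointEndSymShift

/-!
# `DshAn1` — an1's TYPED symmetrised border shift `Dsh` (W-supplier an1 gen 38; couriered to the tree by the row-D1 owner an2 gen 28 in THREE files at the
# 400-line cap: THIS FILE = §1–§4 (datum, border identification, `Gmat` column sums, (Dnull)); `DshAn1Spread` = §5–§6; `DshAn1End` = §7 + an2's §8; bytes of
# every section byte-identical to an1's `HOME/b2b-balaban-beta-an1-g38/sym/DshAn1.lean` fc0da04a7a2642d2, farm rc 0; only headers∕imports differ)

WHAT.  The row-D1 END at the shifted straight spread (`RowD1JointEndSymShift`, R-D1-g28-1) displays ONE datum `Dsh : MKer 4 (Fib 3)` with three letters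
(Dspr) `Spr Dsh`, (Dnull) `symEc ∘ Dsh ∘ symEc = 0`, (V-d).  Referee I-d1ref45-2 ∕ I-d1ref46-1 ∕ C-d1ref44-6: `Dsh` is UN-TYPED (inhabited in the tree only at
`Dsh = 0`).  This file TYPES an1's X-an2-55 object: `Dsh N := bhKSym⁰⁴ − bhK`, the difference between the (0.4)-SYMMETRISED ROOTED border
`±((d+1)!)⁻¹·symLinAvgAt ρ_c` (S1 `SymmetrisedAxialPotential.symLinAvgAt`) and the straight border `±contourSum` of `bhK`; by S1's coarse-exact decomposition
`symLinAvgAt = (d+1)!·contourSum − dz ∘ SymLamAt` it is the coarse gradient of the symmetrised block potential of a bond indicator, placed antisymmetrically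
on the two border blocks.  PROVED here ([folklore], finite sums): the block structure, the dictionary with `bhK` (both border blocks), (Dnull) — the field leg
of `Dsh` is a column-sum of `Gmat`, i.e. lies in the row space, which `Pmat = kerProj Gmat` kills (X-an2-55 §3 «`s = 𝟙ᵀ·Gmat ⇒ Pmat s = 0`») — and (Dspr).
§6: the kernel form `bhK + Dsh = ffK bhK − L^{d+1} • mfNeg (linSym04At ρ_c L)` (twin of an2's `bhKAt_eq_ffK_sub_smul_mfNeg_linSymAt`) and the REDUCTION
`hVd_iff`: against the typed shift, (V-d) ⟺ (S-V)⁰⁴ `∀ u, divV tabs.V u = conjV (mfNeg (linSym04At ρ_c Lc)) (diagK (legInd ρ_c u))` — the (0.4)-twin of an2's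
THEOREM `divV_vhSAt_eq_conjV`, a letter about `tabs.V` ALONE.  §7: the row-D1 END `RowD1JointEndSym.d1Drift_JsB12Sym_of_shiftLetters_D1Tel_D1Rep` instantiated
at `Dsh := Dsh Lc` with (Dspr)(Dnull) DISCHARGED (`d1Drift_JsB12Sym_of_an1Shift_D1Tel_D1Rep`), and with (V-d) replaced by (S-V)⁰⁴ (`…_an1Shift_wardV_…`).
NOT here: (S-V)⁰⁴ itself (a letter about an1's VALUES `tabs.V`, not minted: TABLES-SYM-an1-v2 F0 ∕ C-d1ref44-6), (Wd), (DG).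
HONEST: discharges no TABLE letter; it makes (Dspr)(Dnull) theorems and (V-d) a Ward law of `tabs.V`; root-level classes 0∕5;
NOT D1, NOT BetaPertH, NOT continuum, NOT Clay.  HONEST DEPENDENCY: continuum YM on T⁴ ⇐ BetaPertH ∧ nine spine estimates (0/9 proved); BetaPertH ⇐ (D1) ∧ (D4) ∧
CAP+tail; G-an2-4 gates asym, D1 and NE2/3/4.  No statement of Bałaban's papers, no `[cite:]`, no `Prop` fact; data defs `lam04`, `Dsh`, `colG`, `mfPart`, `fmPart`, `cDsh`,
`lin04KerAt`, `linSym04At` ([our objects — candidates asserting nothing]).  Unit `b2b-balaban-beta-an1` gen 38, 2026-08-21 (scratch v1).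
-/

noncomputable section

open Finset Matrix
open scoped BigOperators Nat
open Literature.Probability.LatticeModels (Torus.proj)
open Literature.MathematicalPhysics.QuantumFieldTheory
open Literature.MathematicalPhysics.QuantumFieldTheory.Balaban1983to89
open Literature.MathematicalPhysics.QuantumFieldTheory.Balaban1983to89.Beta
open B12Sec2to5 (l1 l1_nonneg)
open ExpKernelCalculus (MKer Decays comp)
open AffineAveraging (Form0 Form1 Site unitVec unitVec_apply dz box toSite contourSum)
open AffineReproduction (contourSumAdj)
open AveragingContours (blk shift off off_mem_box blk_add_off blk_block)
open AveragingContoursRooted (ctr ctrOff ctrOff_mem_box)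
open AxialProjector (zsmul_blk_le lt_zsmul_blk_add blk_add_zsmul)
open KKTFluctuationKernel (delta1 delta1_apply)
open LatticeForm (quo)
open OneStepResolventKernel (Fib quo_zsmul eq_zsmul_quo_of_proj proj_zsmul)
open Summit.QuantumFields.BalabanUV.Beta.TameKernelCalculus
open Summit.QuantumFields.BalabanUV.Beta.AxialDressingRooted (cube mem_cube l1_le_of_mem_cube one_le_of_neZero)
open Summit.QuantumFields.BalabanUV.Beta.SymmetrisedAxialPotential
open Summit.QuantumFields.BalabanUV.Beta.SymmetrisedAxialGauge
open Summit.QuantumFields.BalabanUV.Beta.SymmetrisedDressingMatrix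
open Summit.QuantumFields.BalabanUV.Beta.KernelOrthoProjector
open Summit.QuantumFields.BalabanUV.Beta.SymSliceBlockMatrix
open Summit.QuantumFields.BalabanUV.Beta.SymSliceProjectorKernel
open Summit.QuantumFields.BalabanUV.Beta.SymSliceProjectorRules (comp_symEc_apply_inr comp_symEc_apply_inl_of_not_int comp_symEc_apply_inl_of_int)
open Summit.QuantumFields.BalabanUV.Beta.SymSliceProjectorFixed (isIntBond_of_blk_add_unitVec symTreeGaugeAt_bondIndR_of_not_int Gmat_mulVec_Pmat_row)
open Summit.QuantumFields.BalabanUV.Beta.SymGaugeMultiplierBlockMean (bondIndR_eq_delta1)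
open Summit.QuantumFields.BalabanUV.Beta.BorderedHessian (bhK bhK_inl_inl bhK_inl_inr bhK_inr_inl bhK_inr_inr off_eq_zero_iff_proj blk_eq_quo
  cube_mono contourSum_delta1_eq_contourSumAdj)
open Summit.QuantumFields.BalabanUV.Beta.WardLocusStencils (ffK ffK_inl_inl ffK_inl_inr ffK_inr_inl ffK_inr_inr)

namespace Summit.QuantumFields.BalabanUV.Beta.DshAn1

variable {d : ℕ}

/-! ## §1 The datum: `lam04`, `Dsh`, its blocks, antisymmetry, field–field part -/

/-- [our object] The normalised symmetrised block potential of the indicator of the fine bond `(α, x)`, centred root: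
`lam04 N α x Y := ((d+1)!)⁻¹ · SymLamAt ρ_c (δ_{(α,x)}) N Y` (a coarse 0-form). -/
def lam04 (N : ℕ) (α : Fin (d + 1)) (x : Fin (d + 1) → ℤ) : Form0 (d + 1) ℝ :=
  fun Y => ((d + 1) ! : ℝ)⁻¹ * SymLamAt (ctr (d + 1) N) (delta1 α x) N Y

/-- [our object — a CANDIDATE asserting nothing] **an1's SYMMETRISED BORDER SHIFT** `Dsh N := bhKSym⁰⁴ − bhK`: zero on the diagonal blocks; on the
multiplier–field block `−[proj N x = 0]·dz (lam04 N β y) m (x∕N)`, on the field–multiplier block `+[proj N y = 0]·dz (lam04 N α x) m (y∕N)` (antisymmetric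
placement, as `bhK`'s `±𝒬`). -/
def Dsh (N : ℕ) : MKer (d + 1) (Fib d) := fun x y a b =>
  match a, b with
  | Sum.inl _, Sum.inl _ => 0
  | Sum.inl α, Sum.inr m => if Torus.proj N y = 0 then dz (lam04 N α x) m (quo N y) else 0
  | Sum.inr m, Sum.inl β => if Torus.proj N x = 0 then -(dz (lam04 N β y) m (quo N x)) else 0
  | Sum.inr _, Sum.inr _ => 0

variable (N : ℕ)

/-- [folklore] (Dff) the field–field block of `Dsh` vanishes. -/
@[simp] theorem Dsh_inl_inl (x y : Fin (d + 1) → ℤ) (α β : Fin (d + 1)) : Dsh N x y (Sum.inl α) (Sum.inl β) = 0 := rfl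

/-- [folklore] (Dmm) the multiplier–multiplier block of `Dsh` vanishes. -/
@[simp] theorem Dsh_inr_inr (x y : Fin (d + 1) → ℤ) (m m' : Fin (d + 1)) : Dsh N x y (Sum.inr m) (Sum.inr m') = 0 := rfl

/-- [folklore] Field–multiplier entry of `Dsh`: the coarse gradient of `lam04` at coarse `y`. -/
theorem Dsh_inl_inr (x y : Fin (d + 1) → ℤ) (α m : Fin (d + 1)) :
    Dsh N x y (Sum.inl α) (Sum.inr m) = if Torus.proj N y = 0 then dz (lam04 N α x) m (quo N y) else 0 := rfl

/-- [folklore] Multiplier–field entry of `Dsh`: minus the coarse gradient of `lam04` at coarse `x`. -/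
theorem Dsh_inr_inl (x y : Fin (d + 1) → ℤ) (m β : Fin (d + 1)) :
    Dsh N x y (Sum.inr m) (Sum.inl β) = if Torus.proj N x = 0 then -(dz (lam04 N β y) m (quo N x)) else 0 := rfl

/-- [folklore] **ANTISYMMETRIC PLACEMENT**: `Dsh N x y (inr m) (inl β) = − Dsh N y x (inl β) (inr m)`. -/
theorem Dsh_inr_inl_eq_neg (x y : Fin (d + 1) → ℤ) (m β : Fin (d + 1)) :
    Dsh N x y (Sum.inr m) (Sum.inl β) = -Dsh N y x (Sum.inl β) (Sum.inr m) := by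
  rw [Dsh_inr_inl, Dsh_inl_inr]
  split_ifs <;> simp

/-- [folklore] `trK (Dsh N) = − Dsh N`. -/
theorem trK_Dsh : trK (Dsh (d := d) N) = -Dsh N := by
  funext x y a b
  rw [trK_apply, Pi.neg_apply, Pi.neg_apply, Pi.neg_apply, Pi.neg_apply]
  rcases a with α | m <;> rcases b with β | m'
  · simp
  · rw [Dsh_inr_inl_eq_neg]
  · rw [Dsh_inr_inl_eq_neg, neg_neg]
  · simp

/-- [folklore] The field–field part of `Dsh` vanishes. -/
theorem ffK_Dsh : ffK (Dsh (d := d) N) = 0 := by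
  funext x y a b
  rcases a with α | m <;> rcases b with β | m' <;> rfl

/-- [folklore] Hence `ffK (bhK N + Dsh N) = ffK (bhK N)`: the shift does not touch the `d*d` window. -/
theorem ffK_bhK_add_Dsh : ffK (bhK N + Dsh (d := d) N) = ffK (bhK (d := d) N) := by
  funext x y a b
  rcases a with α | m <;> rcases b with β | m'
  · rw [ffK_inl_inl, ffK_inl_inl, Pi.add_apply, Pi.add_apply, Pi.add_apply, Pi.add_apply, Dsh_inl_inl, add_zero]
  · rfl
  · rfl
  · rfl

/-! ## §2 WHAT `bhK + Dsh` IS: the (0.4)-symmetrised rooted border `±((d+1)!)⁻¹ · symLinAvgAt ρ_c` -/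

/-- [folklore] `dz lam04 = ((d+1)!)⁻¹ · dz SymLamAt` entrywise. -/
theorem dz_lam04 (α m : Fin (d + 1)) (x Y : Fin (d + 1) → ℤ) :
    dz (lam04 N α x) m Y = ((d + 1) ! : ℝ)⁻¹ * dz (SymLamAt (ctr (d + 1) N) (delta1 α x) N) m Y := by
  simp only [dz, lam04]; ring

/-- [folklore] **MULTIPLIER–FIELD BLOCK**: `(bhK + Dsh)(x, inr m; y, inl β) = [proj N x = 0] · ((d+1)!)⁻¹ · symLinAvgAt ρ_c (δ_{(β,y)}) N m (x∕N)` (S1). -/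
theorem bhK_add_Dsh_inr_inl (x y : Fin (d + 1) → ℤ) (m β : Fin (d + 1)) :
    (bhK N + Dsh N : MKer (d + 1) (Fib d)) x y (Sum.inr m) (Sum.inl β)
      = if Torus.proj N x = 0 then ((d + 1) ! : ℝ)⁻¹ * symLinAvgAt (ctr (d + 1) N) (delta1 β y) N m (quo N x) else 0 := by
  rw [Pi.add_apply, Pi.add_apply, Pi.add_apply, Pi.add_apply, bhK_inr_inl, Dsh_inr_inl]
  split_ifs with hx
  · rw [symLinAvgAt_eq_contourSum_sub_dz, dz_lam04, mul_sub, ← mul_assoc, inv_mul_cancel₀ factorial_ne_zero_real, one_mul]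
    ring
  · rw [add_zero]

/-- [folklore] **FIELD–MULTIPLIER BLOCK**: `(bhK + Dsh)(x, inl α; y, inr m) = −[proj N y = 0] · ((d+1)!)⁻¹ · symLinAvgAt ρ_c (δ_{(α,x)}) N m (y∕N)`
(S1 + the duality `𝒬 ↔ 𝒬ᵀ` on indicators, `BorderedHessianSymmetry.contourSum_delta1_eq_contourSumAdj`). -/
theorem bhK_add_Dsh_inl_inr [NeZero N] (x y : Fin (d + 1) → ℤ) (α m : Fin (d + 1)) :
    (bhK N + Dsh N : MKer (d + 1) (Fib d)) x y (Sum.inl α) (Sum.inr m)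
      = if Torus.proj N y = 0 then -(((d + 1) ! : ℝ)⁻¹ * symLinAvgAt (ctr (d + 1) N) (delta1 α x) N m (quo N y)) else 0 := by
  rw [Pi.add_apply, Pi.add_apply, Pi.add_apply, Pi.add_apply, bhK_inl_inr, Dsh_inl_inr]
  split_ifs with hy
  · rw [← contourSum_delta1_eq_contourSumAdj, symLinAvgAt_eq_contourSum_sub_dz, dz_lam04, mul_sub, ← mul_assoc,
      inv_mul_cancel₀ factorial_ne_zero_real, one_mul]
    ring
  · rw [add_zero]

/-! ## §3 The symmetrised block potential of a bond indicator: support and the `Gmat` column sums -/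

/-- [folklore] `SymLamAt` as a sum of symmetrised tree gauges over the block. -/
theorem SymLamAt_eq_sum_symTreeGaugeAt (A : Form1 (d + 1) ℝ) (Y : Fin (d + 1) → ℤ) :
    SymLamAt (ctr (d + 1) N) A N Y = ∑ b ∈ box (d + 1) N, symTreeGaugeAt (ctr (d + 1) N) A N ((N : ℤ) • Y + toSite b) := by
  rw [SymLamAt]
  refine Finset.sum_congr rfl fun b hb => ?_
  rw [show ctr (d + 1) N = toSite (ctrOff (d + 1) N) from rfl, symTreeGaugeAt_block _ A Y hb]

/-- [folklore] **SUPPORT, FACE-CROSSING BONDS**: the indicator of a non-interior bond has vanishing symmetrised block potential everywhere. -/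
theorem SymLamAt_delta1_of_not_int {N : ℕ} (hN : 1 ≤ N) {α : Fin (d + 1)} {x : Fin (d + 1) → ℤ} (hα : ¬ IsIntBond N α x) (Y : Fin (d + 1) → ℤ) :
    SymLamAt (ctr (d + 1) N) (delta1 α x) N Y = 0 := by
  rw [SymLamAt_eq_sum_symTreeGaugeAt]
  refine Finset.sum_eq_zero fun b _ => ?_
  rw [← bondIndR_eq_delta1, show ctr (d + 1) N = toSite (ctrOff (d + 1) N) from rfl]
  exact symTreeGaugeAt_bondIndR_of_not_int hN (ctrOff_mem_box hN) hα _

/-- [folklore] Hence `lam04 N α x = 0` and its coarse gradient vanishes for a non-interior bond. -/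
theorem dz_lam04_of_not_int {N : ℕ} (hN : 1 ≤ N) {α : Fin (d + 1)} {x : Fin (d + 1) → ℤ} (hα : ¬ IsIntBond N α x) (m : Fin (d + 1))
    (Y : Fin (d + 1) → ℤ) : dz (lam04 N α x) m Y = 0 := by
  simp only [dz, lam04, SymLamAt_delta1_of_not_int hN hα, mul_zero, sub_self]

/-- [folklore] **SUPPORT, OTHER BLOCKS**: the symmetrised tree gauge of the indicator of a bond of block `B` vanishes at every point outside block `B`. -/
theorem symTreeGaugeAt_delta1_of_blk_ne {N : ℕ} (hN : 1 ≤ N) {α : Fin (d + 1)} {x z : Fin (d + 1) → ℤ} (hz : blk N z ≠ blk N x) :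
    symTreeGaugeAt (ctr (d + 1) N) (delta1 α x) N z = 0 := by
  rw [show ctr (d + 1) N = toSite (ctrOff (d + 1) N) from rfl,
    symTreeGaugeAt_congr hN (ctrOff_mem_box hN) (A' := (0 : Form1 (d + 1) ℝ))]
  · exact symTreeGaugeAt_zero _ _ _
  · intro κ w hw _
    rw [delta1_apply, Pi.zero_apply, Pi.zero_apply]
    split_ifs with h
    · obtain ⟨-, rfl⟩ := h
      exact absurd hw.symm hz
    · rfl

/-- [folklore] **TRANSLATION TO BLOCK `0`**: for an offset `c` and a block point `N•B + b`,
`symTreeGaugeAt ρ_c (δ_{(α, N•B + c)}) N (N•B + b) = symTreeGaugeAt ρ_c (δ_{(α, c)}) N b` (both `b`, `c` sites of block `0`). -/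
theorem symTreeGaugeAt_delta1_block {N : ℕ} (B : Fin (d + 1) → ℤ) (α : Fin (d + 1)) {c b : Fin (d + 1) → ℕ}
    (hb : b ∈ box (d + 1) N) :
    symTreeGaugeAt (ctr (d + 1) N) (delta1 α ((N : ℤ) • B + toSite c)) N ((N : ℤ) • B + toSite b)
      = symTreeGaugeAt (ctr (d + 1) N) (delta1 α (toSite c)) N (toSite b) := by
  rw [show ctr (d + 1) N = toSite (ctrOff (d + 1) N) from rfl, symTreeGaugeAt_block _ _ B hb]
  have h0 : symTreeGaugeAt (toSite (ctrOff (d + 1) N)) (delta1 α (toSite c)) N (toSite b)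
      = symAxial (delta1 α (toSite c)) (toSite (ctrOff (d + 1) N)) (toSite b) := by
    have := symTreeGaugeAt_block (ctrOff (d + 1) N) (delta1 α (toSite c)) (0 : Fin (d + 1) → ℤ) hb
    simpa using this
  rw [h0, show (N : ℤ) • B + toSite (ctrOff (d + 1) N) = toSite (ctrOff (d + 1) N) + (N : ℤ) • B from add_comm _ _,
    show (N : ℤ) • B + toSite b = toSite b + (N : ℤ) • B from add_comm _ _, symAxial_add]
  congr 1
  funext κ w
  simp only [shift, delta1_apply]
  have e : w + (N : ℤ) • B = (N : ℤ) • B + toSite c ↔ w = toSite c := by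
    rw [add_comm ((N : ℤ) • B) (toSite c)]
    exact add_left_inj _
  simp only [e]

/-- [our object] **THE COLUMN SUM OF `Gmat` OVER THE BLOCK** (root point included, where the tree gauge vanishes):
`colG N j := Σ_{b ∈ box} symTreeGaugeAt ρ_c (δ_j) N b`. -/
def colG (N : ℕ) (j : BIdx (d + 1) N) : ℝ :=
  ∑ b ∈ box (d + 1) N, symTreeGaugeAt (ctr (d + 1) N) (delta1 j.1.1 (toSite j.1.2)) N (toSite b)

/-- [folklore] The summand of `colG` is the `Gmat` entry off the root and `0` at the root. -/
theorem symTreeGaugeAt_delta1_toSite_eq {N : ℕ} (hN : 1 ≤ N) (j : BIdx (d + 1) N) {b : Fin (d + 1) → ℕ} (hb : b ∈ box (d + 1) N) :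
    symTreeGaugeAt (ctr (d + 1) N) (delta1 j.1.1 (toSite j.1.2)) N (toSite b)
      = if h : b ∈ cIdxSet (d + 1) N then Gmat N ⟨b, h⟩ j else 0 := by
  by_cases h : b ∈ cIdxSet (d + 1) N
  · rw [dif_pos h, Gmat, bondIndR_eq_delta1]
  · rw [dif_neg h]
    have hb' : b = ctrOff (d + 1) N := by
      by_contra hne
      exact h (Finset.mem_erase.2 ⟨hne, hb⟩)
    rw [hb', show ctr (d + 1) N = toSite (ctrOff (d + 1) N) from rfl]
    have := symTreeGaugeAt_root (ctrOff_mem_box hN) (delta1 j.1.1 (toSite j.1.2)) (0 : Fin (d + 1) → ℤ)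
    simpa using this

/-- [folklore] **THE ROW-SPACE LEMMA** (X-an2-55 §3): `Σ_j Pmat i j · colG j = 0` — the column-sum vector lies in the row space of `Gmat`, which the
block-orthogonal kernel projector annihilates (`SymSliceProjectorFixed.Gmat_mulVec_Pmat_row`). -/
theorem sum_Pmat_mul_colG {N : ℕ} (hN : 1 ≤ N) (i : BIdx (d + 1) N) : ∑ j : BIdx (d + 1) N, Pmat N i j * colG N j = 0 := by
  simp only [colG, Finset.mul_sum]
  rw [Finset.sum_comm]
  refine Finset.sum_eq_zero fun b hb => ?_
  simp only [symTreeGaugeAt_delta1_toSite_eq hN _ hb]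
  by_cases h : b ∈ cIdxSet (d + 1) N
  · simp only [dif_pos h]
    have hz := congrFun (Gmat_mulVec_Pmat_row hN i) ⟨b, h⟩
    rw [Matrix.mulVec, dotProduct, Pi.zero_apply] at hz
    rw [← hz]
    exact Finset.sum_congr rfl fun j _ => mul_comm _ _
  · simp only [dif_neg h, mul_zero, Finset.sum_const_zero]

/-- [folklore] **THE BLOCK POTENTIAL OF AN INTERIOR BOND INDICATOR IS THE COLUMN SUM, ON ITS OWN BLOCK ONLY**:
`SymLamAt ρ_c (δ_{(j.1, N•B + j.2)}) N Y = [Y = B] · colG N j`. -/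
theorem SymLamAt_delta1_block {N : ℕ} (hN : 1 ≤ N) (B : Fin (d + 1) → ℤ) (j : BIdx (d + 1) N) (Y : Fin (d + 1) → ℤ) :
    SymLamAt (ctr (d + 1) N) (delta1 j.1.1 ((N : ℤ) • B + toSite j.1.2)) N Y = if Y = B then colG N j else 0 := by
  have hc : j.1.2 ∈ box (d + 1) N := (mem_bIdxSet.1 j.2).1
  rw [SymLamAt_eq_sum_symTreeGaugeAt]
  by_cases hY : Y = B
  · rw [if_pos hY, hY, colG]
    exact Finset.sum_congr rfl fun b hb => symTreeGaugeAt_delta1_block B j.1.1 hb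
  · rw [if_neg hY]
    refine Finset.sum_eq_zero fun b hb => symTreeGaugeAt_delta1_of_blk_ne hN ?_
    rw [blk_block Y hb, blk_block B hc]
    exact hY

/-- [folklore] **KEY**: for an interior bond `(α, x)` and every coarse `(m, Y)`, the `Pmat`-projected block column of the field legs of `Dsh` vanishes:
`Σ_j Pmat (α, off x) j · dz (lam04 N j.1 (N•blk x + j.2)) m Y = 0`. -/
theorem sum_Pmat_mul_dz_lam04 {N : ℕ} (hN : 1 ≤ N) {x : Fin (d + 1) → ℤ} {α : Fin (d + 1)} (hα : IsIntBond N α x) (m : Fin (d + 1))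
    (Y : Fin (d + 1) → ℤ) :
    ∑ j : BIdx (d + 1) N, Pmat N ⟨(α, off N x), hα⟩ j * dz (lam04 N j.1.1 ((N : ℤ) • blk N x + toSite j.1.2)) m Y = 0 := by
  simp only [dz, lam04, SymLamAt_delta1_block hN (blk N x)]
  have h0 := sum_Pmat_mul_colG hN ⟨(α, off N x), hα⟩
  have hc : ∑ j : BIdx (d + 1) N, Pmat N ⟨(α, off N x), hα⟩ j * (((d + 1) ! : ℝ)⁻¹ * colG N j) = 0 := by
    calc ∑ j : BIdx (d + 1) N, Pmat N ⟨(α, off N x), hα⟩ j * (((d + 1) ! : ℝ)⁻¹ * colG N j)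
        = ((d + 1) ! : ℝ)⁻¹ * ∑ j : BIdx (d + 1) N, Pmat N ⟨(α, off N x), hα⟩ j * colG N j := by
          rw [Finset.mul_sum]; exact Finset.sum_congr rfl fun j _ => by ring
      _ = 0 := by rw [h0, mul_zero]
  by_cases h1 : Y + unitVec m = blk N x <;> by_cases h2 : Y = blk N x
  · simp only [if_pos h1, if_pos h2, sub_self, mul_zero, Finset.sum_const_zero]
  · simp only [if_pos h1, if_neg h2, mul_zero, sub_zero]; exact hc
  · simp only [if_neg h1, if_pos h2, mul_zero, zero_sub, mul_neg, Finset.sum_neg_distrib, hc, neg_zero]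
  · simp only [if_neg h1, if_neg h2, sub_self, mul_zero, Finset.sum_const_zero]

/-! ## §4 (Dnull): `symEc ∘ Dsh ∘ symEc = 0` -/

/-- [our object] The multiplier–field part of a kernel. -/
def mfPart (K : MKer (d + 1) (Fib d)) : MKer (d + 1) (Fib d) := fun x y a b =>
  match a, b with
  | Sum.inr m, Sum.inl β => K x y (Sum.inr m) (Sum.inl β)
  | Sum.inl _, Sum.inl _ => 0
  | Sum.inl _, Sum.inr _ => 0
  | Sum.inr _, Sum.inr _ => 0

/-- [our object] The field–multiplier part of a kernel. -/
def fmPart (K : MKer (d + 1) (Fib d)) : MKer (d + 1) (Fib d) := fun x y a b =>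
  match a, b with
  | Sum.inl α, Sum.inr m => K x y (Sum.inl α) (Sum.inr m)
  | Sum.inl _, Sum.inl _ => 0
  | Sum.inr _, Sum.inl _ => 0
  | Sum.inr _, Sum.inr _ => 0

/-- [folklore] `trK (mfPart (Dsh N)) = − fmPart (Dsh N)` (antisymmetric placement). -/
theorem trK_mfPart_Dsh : trK (mfPart (Dsh (d := d) N)) = -fmPart (Dsh N) := by
  funext x y a b
  rw [trK_apply, Pi.neg_apply, Pi.neg_apply, Pi.neg_apply, Pi.neg_apply]
  rcases a with α | m <;> rcases b with β | m'
  · show (0 : ℝ) = -0; rw [neg_zero]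
  · show Dsh N y x (Sum.inr m') (Sum.inl α) = -Dsh N x y (Sum.inl α) (Sum.inr m')
    exact Dsh_inr_inl_eq_neg N y x m' α
  · show (0 : ℝ) = -0; rw [neg_zero]
  · show (0 : ℝ) = -0; rw [neg_zero]

/-- [folklore] **FIELD ROWS OF `symEc ∘ Dsh` INTO MULTIPLIER LEGS VANISH** (face-crossing rows by support, interior rows by the row-space lemma). -/
theorem comp_symEc_Dsh_inl_inr {N : ℕ} (hN : 1 ≤ N) (x y : Fin (d + 1) → ℤ) (α m : Fin (d + 1)) :
    comp (symEc N) (Dsh N) x y (Sum.inl α) (Sum.inr m) = 0 := by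
  by_cases hα : IsIntBond N α x
  · rw [comp_symEc_apply_inl_of_int hN _ hα]
    simp only [Dsh_inl_inr]
    split_ifs with hy
    · exact sum_Pmat_mul_dz_lam04 hN hα m (quo N y)
    · simp
  · rw [comp_symEc_apply_inl_of_not_int _ hα, Dsh_inl_inr]
    split_ifs with hy
    · exact dz_lam04_of_not_int hN hα m _
    · rfl

/-- [folklore] The same for the field–multiplier part alone. -/
theorem comp_symEc_fmPart_Dsh_inl_inr {N : ℕ} (hN : 1 ≤ N) (x y : Fin (d + 1) → ℤ) (α m : Fin (d + 1)) :
    comp (symEc N) (fmPart (Dsh N)) x y (Sum.inl α) (Sum.inr m) = 0 := by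
  by_cases hα : IsIntBond N α x
  · rw [comp_symEc_apply_inl_of_int hN _ hα]
    show ∑ j : BIdx (d + 1) N, Pmat N ⟨(α, off N x), hα⟩ j * Dsh N ((N : ℤ) • blk N x + toSite j.1.2) y (Sum.inl j.1.1) (Sum.inr m) = 0
    simp only [Dsh_inl_inr]
    split_ifs with hy
    · exact sum_Pmat_mul_dz_lam04 hN hα m (quo N y)
    · simp
  · rw [comp_symEc_apply_inl_of_not_int _ hα]
    show Dsh N x y (Sum.inl α) (Sum.inr m) = 0
    rw [Dsh_inl_inr]
    split_ifs with hy
    · exact dz_lam04_of_not_int hN hα m _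
    · rfl

/-- [folklore] **`symEc ∘ Dsh = mfPart Dsh`**: the left slice projector kills the field rows and keeps the (already coarse) multiplier rows. -/
theorem comp_symEc_Dsh {N : ℕ} (hN : 1 ≤ N) : comp (symEc N) (Dsh (d := d) N) = mfPart (Dsh N) := by
  funext x y a b
  rcases a with α | m <;> rcases b with β | m'
  · -- field → field: `Dsh_inl_inl = 0`
    show comp (symEc N) (Dsh N) x y (Sum.inl α) (Sum.inl β) = 0
    by_cases hα : IsIntBond N α x
    · rw [comp_symEc_apply_inl_of_int hN _ hα]
      simp
    · rw [comp_symEc_apply_inl_of_not_int _ hα, Dsh_inl_inl]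
  · exact comp_symEc_Dsh_inl_inr hN x y α m'
  · show comp (symEc N) (Dsh N) x y (Sum.inr m) (Sum.inl β) = Dsh N x y (Sum.inr m) (Sum.inl β)
    rw [comp_symEc_apply_inr, Dsh_inr_inl]
    split_ifs <;> rfl
  · show comp (symEc N) (Dsh N) x y (Sum.inr m) (Sum.inr m') = 0
    rw [comp_symEc_apply_inr, Dsh_inr_inr]
    split_ifs <;> rfl

/-- [folklore] **`symEc ∘ fmPart Dsh = 0`**. -/
theorem comp_symEc_fmPart_Dsh {N : ℕ} (hN : 1 ≤ N) : comp (symEc N) (fmPart (Dsh (d := d) N)) = 0 := by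
  funext x y a b
  rw [Pi.zero_apply, Pi.zero_apply, Pi.zero_apply, Pi.zero_apply]
  rcases a with α | m <;> rcases b with β | m'
  · by_cases hα : IsIntBond N α x
    · rw [comp_symEc_apply_inl_of_int hN _ hα]
      exact Finset.sum_eq_zero fun j _ => by show Pmat N _ j * 0 = 0; rw [mul_zero]
    · rw [comp_symEc_apply_inl_of_not_int _ hα]; rfl
  · exact comp_symEc_fmPart_Dsh_inl_inr hN x y α m'
  · rw [comp_symEc_apply_inr]; split_ifs <;> rfl
  · rw [comp_symEc_apply_inr]; split_ifs <;> rfl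

/-- [folklore] **(Dnull) `symEc ∘ Dsh ∘ symEc = 0`** — the hypothesis `hDnull` of `WardLocusSymShift.hSd_JsB12Sym0` ∕ `RowD1JointEndSymShift` §8–§9 ∕
`RelInvNullShift.relInv_Gsym_bhKStep_add`, as a THEOREM for an1's `Dsh`. -/
theorem comp_comp_symEc_Dsh_symEc {N : ℕ} (hN : 1 ≤ N) : comp (comp (symEc N) (Dsh (d := d) N)) (symEc N) = 0 := by
  rw [comp_symEc_Dsh hN]
  have h : trK (comp (mfPart (Dsh (d := d) N)) (symEc N)) = 0 := by
    rw [trK_comp, trK_symEc, trK_mfPart_Dsh, comp_neg_right, comp_symEc_fmPart_Dsh hN, neg_zero]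
  have h' := congrArg trK h
  rw [trK_trK] at h'
  rw [h']
  rfl

end Summit.QuantumFields.BalabanUV.Beta.DshAn1

end
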